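import Literature.Claims.NS.Ramm2024
import Literature.Analysis.FluidPDE.MildSolutions
import Literature.Analysis.FunctionSpaces.HomSobolevInterpolation
import Literature.Analysis.FunctionSpaces.FourierSobolevNormProofs
import Mathlib.Analysis.Distribution.Sobolev
import HarnessLib

/-!
# Claim skeleton C04b `Ramm2019` — A. G. Ramm, «Solution of the Navier–Stokes problem»,
# Applied Mathematics Letters 87 (2019) 160–164 (REGULARITY direction; sub-row of C04 `Ramm2024`)

DISPUTED CLAIM under adjudication (cell `ns-claims`, D-0090; typist `ns-claims-typist-4`, refuter
`ns-claims-refuter-2`, referee `ns-claims-ref-1`). **Nothing in this file asserts a step**: the claimed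
theorem and every load-bearing step are `Prop`-valued definitions; the theorems are the kernel
composition (pure logic) and the Clay link. Bib key `Ramm2019` (doi 10.1016/j.aml.2018.07.034). TEXT
TYPED = the author's arXiv version **arXiv:1904.11569v1** (21 Apr 2019; arXiv JREF «Appl. Math. Lett. 87
(2019) 160-164»), the provisional pin of `sources/Ramm2019/LOCATORS.md` while the printed pages are
WANTED (acq-11688); locators are the equation labels (e1)–(e17) and TeX line numbers of that file
(`684.tex`). CAUTION: arXiv:1904.11569 **v2** (2021) is a different, retitled text of the OPPOSITE
direction (the «NSP paradox», typed as `Literature.Claims.NS.Ramm2024`); the inequality chain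
(e6)→(e10)→(e11)→(e11a) below is the 2019 twin of (1.19)→(1.29)→(2.38)→(2.39) there, read in 2019 as
proving a global `H¹` bound and from 2020 on as proving `v₀ = 0`.

## Claimed statement (provisional text, verbatim)

Introduction l.111–122: «The global existence and uniqueness of a solution in ℝ³ was not yet proved. It
is mentioned as one of the millennium problems in [LR]. This problem is solved in our paper. … the
solution to NS problem is defined as a solution to some integral equation. It is proved that this
solution is unique, it exists globally, i.e. for all t ≥ 0, and is uniformly bounded in the Sobolev
space H¹(ℝ³) provided that the free term f decays sufficiently fast as |x| + t → ∞ and the initial data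
v₀(x) decays sufficiently fast as |x| → ∞.» **Theorem 1** (l.162–166): «A solution to problem (e1)
satisfies the following a priori estimates: N₀(v) ≤ c₀, N₀(∇v) ≤ c(t) (e4), where the constant c₀ > 0
does not depend on t and c(t) is a continuous function defined for all t ≥ 0.» **Theorem 2** (l.171):
«Problem (e1) has a solution in X and this solution is unique in X.» Here (l.123–156): (e1) is the
Navier–Stokes system in `ℝ³`, `ν > 0`, with force `f` and datum `v₀`, `∇·v₀ = 0`; «By the solution a
solution to an integral equation is understood» — (e2) `v = F − ∫₀ᵗ ds ∫ G(x−y,t−s)(v,∇)v dy` («equivalent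
to (e1)», [R673] = `Ramm2017`); `X` = «continuous functions with respect to t with values in L²(ℝ³)»,
norm `sup_{t∈[0,T]} ‖v(·,t)‖`, «T > 0 is an arbitrary large fixed number»; `N₀ = ‖·‖_{L²(ℝ³)}`. Closing
sentence l.377: «It follows from Theorem 2 that there cannot be turbulent motions of fluid in the NS
problem in the whole space ℝ³ if the data f and v₀ are smooth and rapidly decaying.»

TYPED INSTANCE (special case, recorded as Δ3/Δ4): force `f ≡ 0` and Clay data (smooth, rapidly
decaying, divergence-free `v₀`) — the instance that bears on Clay (A); the print admits decaying
forces `f` with `∫₀^∞ N₀(f) dt < ∞` and data with `|v₀| + |∇v₀| = O(|x|^{−a})`, `a > 3`.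
-- TODO(general form): forced version with the Oseen–Duhamel term `∫₀ᵗ G(t−s) f(s) ds` of (e3).

## Clay delta (reference `Literature.Claims.NS.ClayVariants`, axes of its §3)

Direction REGULARITY; nearest Clay statement (A) = `ClayVariants.clayR3.Regularity`. Δ1 `ℝ³` =; Δ2 =;
Δ3 force: print admits decaying `f` (stronger direction), typed instance `f ≡ 0`; Δ4 data: print's class
is wider than Clay (4), typed instance = Clay data; **Δ5 solution notion: «solution» = solution of the
integral equation (e2) in `X = C([0,T]; L²(ℝ³))` — no smoothness on `ℝ³ × [0,∞)`, no pressure; the bridge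
from such solutions to Clay-sense smooth solutions with bounded energy is a regularity statement the
paper does not contain — typed as the explicit hypothesis `ClayDelta`** (`clay_of_claimed :
ClaimedTheorem → ClayDelta → clayR3.Regularity`); Δ6 conclusion: existence AND uniqueness on every
`[0,T]` (Theorem 2 as printed, `T` arbitrary); Δ7 every `ν > 0` =.

## Step index (dependency order = argument order of `claim_of_steps`; locators arXiv:1904.11569v1)

* Step 1 = `Step1_energyBound` — §2 (a) l.177–185, first half of (e4): `N₀(v) ≤ ∫₀ᵗ N₀(f) ds + N₀(v₀)`
  (`f ≡ 0`: `‖v(·,t)‖ ≤ ‖v₀‖`).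
* Step 2 = `Step2_hyperSingularIneq` — §2 (b): (e6) l.201–204 «ψ(t) ≤ N₀(|ξ|F̃) + c∫₀ᵗ N₀(|ξ||G̃(ξ,t−s)|)
  ψ(s) ds», `ψ(t) := N₀(∇v) = N₀(|ξ|ṽ)` (Parseval), with the kernel bound (e7) l.210–212
  «N₀(|ξ||G̃|) ≤ c[ν(t−s)]^{−5/4}», IN THE SENSE (e10) l.258–264: «One has ∫₀ᵗ(t−s)^{−5/4}ψ ds =
  Γ(−¼)Φ_{−1/4}⋆ψ. Inequality (e6) can be written as ψ ≤ ψ₀ + cΓ(−¼)Φ_{−1/4}⋆ψ, ψ₀ := N₀(|ξ|F̃)», with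
  «Γ(−¼) = −4Γ(3/4) := −b^{−1}, b > 0», `Φ_λ(t) = t₊^{λ−1}/Γ(λ)` as distributions, `Φ_λ⋆Φ_μ = Φ_{λ+μ}`,
  `Φ_λ⋆Φ_{−λ} = I` (l.237–248, Gel'fand–Shilov). THE TYPIST'S PRE-REGISTERED PREDICTED FAILING STEP
  (CARD §4, 2026-08-26T18:15Z).
* Step 3 = `Step3_majorant` — (e11b) l.275–280: the equation `h = c^{−1}b Φ_{1/4}⋆ψ₀ − c^{−1}b Φ_{1/4}⋆h`
  «is solvable by iterations and the iterations converge by Lemma 2. The solution h is bounded by a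
  constant depending only on the data … 0 ≤ t ≤ T» (Lemma 1 l.218–230, Lemma 2 l.232–236).
* Step 4 = `Step4_comparison` — (e11)→(e11a) l.265–274: «Applying to (e10) the operator Φ_{1/4}⋆ and
  multiplying by c^{−1}b one gets (e11) ψ ≤ c^{−1}bΦ_{1/4}⋆ψ₀ − c^{−1}bΦ_{1/4}⋆ψ. Using Lemmas 1 and 2 one
  derives from (e11) by iterations that (e11a) ψ(t) ≤ h(t)».
* Step 5 = `Step5_aprioriBound` — Theorem 1, second half of (e4) l.162–166 / l.281–283: `N₀(∇v(·,t)) ≤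
  c(t)`, `c` continuous on `[0,∞)` depending on the data only.
* Step 6 = `Step6_uniqueness` — Theorem 2, uniqueness in `X` (§3 l.294–322, (e12a)–(e13)).
* Step 7 = `Step7_localExistence` — §3 l.324–365, (e13a)–(e17): `B` is a contraction on a ball of `X`
  for `0 ≤ t ≤ τ`, `τ` small: a solution exists in `X` on `[0,τ]`.
* Step 8 = `Step8_continuation` — §3 l.366–375: «The a priori estimates (e4) do not depend on τ ≤ T.
  Therefore one can repeat the argument for τ ≤ t ≤ 2τ … in finitely many steps get the existence of
  the unique in X solution in [0,T]» — a continuation step of FIXED length `τ` (depending on the data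
  only) past any solution on `[0,T]`.

COMPOSITION: proved as `claim_of_steps` (Steps 1–8 ⊢ `ClaimedTheorem`; the headline consumes Steps
6, 7, 8: local existence + uniform continuation by induction, uniqueness verbatim —
`claimedTheorem_of_steps_678`). Printed derivations that are proofs in print, not statements: Step 1 ∧
(e5)–(e7) ⊢ Step 2 (as in C04: the Minkowski/sup bound produces the classical integral with the
non-integrable kernel `(t−s)^{−5/4}`, = `+∞` for `ψ > 0` near `s = t`; the value `Γ(−¼)(Φ_{−1/4}⋆ψ)(t)` of
(e10) enters by the distributional definition l.237–258); Steps 2–4 ⊢ Step 5 (l.281–283); Step 5 ⊢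
Step 8 (l.370: «the a priori estimates (e4) do not depend on τ»).

## Typing notes

* `ψ(t) = N₀(∇v) = N₀(|ξ|ṽ)` (unitary Fourier transform, l.189–199) is typed Fourier-side by the tree's
  homogeneous Sobolev seminorm `Function.eHomSobolevSeminorm 1` of `v(·,t)` (junk `⊤` off `L²`; the
  solutions of `X` are `L²`-valued) — equal to `ψ(t)` up to the fixed factor `2π` of Mathlib's Fourier
  convention, immaterial in the homogeneous displays (e10)–(e11b); `ψ₀(t) = N₀(|ξ|F̃(ξ,t))` is the same
  functional of `F(·,t) = e^{νtΔ}v₀` (`f ≡ 0`; tree `heatTest`). Values are carried in `ℝ≥0∞` and made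
  real by `toReal`; where a display treats `ψ(t)` as a number the step states finiteness.
* `Φ_{−1/4} ⋆ ψ` is typed, as in C04, by the Laplace-side characterization
  `Literature.Claims.NS.Ramm2024.IsPhiConv (−1/4) ψ w` (`Lw = p^{1/4}·Lψ` for real `p > 0`, `w` continuous
  on `(0,∞)`), which is the Laplace image of the Gel'fand–Shilov distribution `t₊^{λ−1}/Γ(λ)` used here
  (l.237–248) and the explicit definition of the author's later texts; `c^{−1}b`-type constants use
  `Ramm2024.c₁ = |Γ(−¼)| = 4Γ(3/4) = b^{−1}`; `Φ_{1/4} ⋆ g (t) = Γ(¼)^{−1} ∫₀ᵗ (t−s)^{−3/4} g(s) ds` is the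
  classical Abel integral (`Ramm2024.volterra (−3/4)`).
* Constants: «c stands for various constants independent of t» (l.205), built from `c₀ = c₀(data)` and
  `ν` — typed `∀ data, ∃ c > 0, ∀ solutions` (F11). Steps 3–4 are stated for every `c > 0`.
* Solution class: global `X`-solutions — `v` with, for every `T > 0`, the tree's mild (Duhamel, duality
  form) predicate `IsMildNSSolutionOn (Icc 0 T) ν 0 v₀ v`, `v ∈ C([0,T]; L²)` (`ContinuousInLpOn`) and
  `v 0 = v₀` (`InX`); Theorem 1 is printed for solutions on `[0,T]`, `T` arbitrary — typed for global
  `X`-solutions (the sub-case the continuation argument uses; a class restriction only weakens a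
  ∀-step), so that the half-line convolutions of (e10) are meaningful as printed («convolution in
  [0,∞)», l.246).

REV 2 (ADDITIVE, ns-claims-typist-7 g4, 2026-08-27; records hygiene after the cell's ON-PATH AUDIT #1–#116,
finding (ii), chair ruling STATUS 05:34:08Z): the printed derivation «Steps 2–4 ⊢ Step 5» (l.281–283 «By
(e11a) the ψ is bounded by h. Since T > 0 is arbitrary, the second estimate (e4) is proved») is now a KERNEL
theorem `step5_of_step2_step3_step4 : Step2_hyperSingularIneq → Step3_majorant → Step4_comparison →
Step5_aprioriBound` (the C04b twin of `Ramm2024.step6_of_step3_step4_step5`), with the auxiliary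
`memHomSobolev_complexify_of_dataHyp` (a Clay datum lies in `Ḣ¹ ∩ L²`, so `ψ(0) = N₀(∇v₀)` is finite — the
only ingredient the printed sentence leaves implicit). Nothing above is changed; no step is asserted; the
verdict of record (#29: `Step2_hyperSingularIneq` false, `not_Step2_hyperSingularIneq` p-file
`Theorems/SoloRefuteRamm2019.lean`) is untouched — Step 2 stays a `_` binder of `claim_of_steps` whose kernel
link to the consumed chain is this derivation (ON-PATH category P → D).

WHAT THIS IS NOT: not a claim about NS regularity or blow-up; not a claim about any author beyond
the typed locator.
-/

open scoped ContDiff ENNReal Topology SchwartzMap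
open _root_.MeasureTheory _root_.Set _root_.Filter

namespace Literature.Claims.NS.Ramm2019

open Literature.Analysis.FluidPDE Literature.Analysis.Asymptotics Literature.Analysis
open Literature.Claims.NS.Ramm2024 (IsPhiConv c₁ volterra)

noncomputable section

/-! ## Setting: data, the space `X`, the quantities `ψ`, `ψ₀` -/

/-- The data hypotheses of the typed instance: `ν > 0`, `f ≡ 0`, `v₀` smooth, rapidly decaying and
divergence free (arXiv:1904.11569v1 (e1) l.123–133 with the Clay data class; the print's class
`|v₀| + |∇v₀| = O(|x|^{−a})`, `a > 3`, is wider — module docstring Δ4).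
[cite: Ramm2019, (e1) l.123–133 of arXiv:1904.11569v1] -/
structure DataHyp (ν : ℝ) (v₀ : EuclideanSpace ℝ (Fin 3) → EuclideanSpace ℝ (Fin 3)) : Prop where
  /-- `ν = const > 0`. -/
  viscosity_pos : 0 < ν
  /-- `v₀` smooth. -/
  data_smooth : ContDiff ℝ ∞ v₀
  /-- `v₀` rapidly decaying with all derivatives (Clay (4)). -/
  data_decay : HasRapidSpatialDecay v₀
  /-- `∇ · v₀ = 0`. -/
  data_divFree : NSWave0.IsDivFree v₀

/-- `v ∈ X` solves the integral equation (e2) on `[0,T]` with datum `v₀` and `f ≡ 0`: «X [is] the Banach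
space of continuous functions with respect to t with values in L²(ℝ³)» (l.150–154) — tree
`ContinuousInLpOn (Icc 0 T) 2` — and (e2) (Duhamel form with the Oseen tensor, «equivalent to (e1)»,
l.136–139) — tree `IsMildNSSolutionOn (Icc 0 T)` (duality form), plus the initial condition `v(0) = v₀`.
[cite: Ramm2019, (e2) l.136 and the definition of X l.150–156] -/
def InX (ν : ℝ) (v₀ : EuclideanSpace ℝ (Fin 3) → EuclideanSpace ℝ (Fin 3)) (T : ℝ)
    (v : ℝ → EuclideanSpace ℝ (Fin 3) → EuclideanSpace ℝ (Fin 3)) : Prop :=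
  IsMildNSSolutionOn (Icc 0 T) ν 0 v₀ v ∧ ContinuousInLpOn (Icc 0 T) 2 v ∧ v 0 = v₀

/-- A GLOBAL `X`-solution: an `X`-solution on `[0,T]` for every `T > 0` («Since T > 0 is arbitrary, the
solution exists for all T > 0», l.375). [cite: Ramm2019, Thm 2 l.171 and l.375] -/
def IsGlobalX (ν : ℝ) (v₀ : EuclideanSpace ℝ (Fin 3) → EuclideanSpace ℝ (Fin 3))
    (v : ℝ → EuclideanSpace ℝ (Fin 3) → EuclideanSpace ℝ (Fin 3)) : Prop :=
  ∀ T : ℝ, 0 < T → InX ν v₀ T v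

/-- `ψ(t) := N₀(∇v) = N₀(|ξ|ṽ)` (l.186–199, unitary Fourier transform and Parseval), in `ℝ≥0∞`, typed by
the Fourier-side homogeneous Sobolev seminorm `‖v(·,t)‖_{Ḣ¹}` of the tree (`= ψ(t)/(2π)` by Mathlib's
Fourier convention; junk `⊤` off `L²`). [cite: Ramm2019, definition of ψ l.199] -/
def psiE (v : ℝ → EuclideanSpace ℝ (Fin 3) → EuclideanSpace ℝ (Fin 3)) (t : ℝ) : ℝ≥0∞ :=
  Function.eHomSobolevSeminorm 1 (FunctionSpaces.EuclideanSpace.complexify ∘ v t)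

/-- `ψ(t)` as a real number (`toReal`; `0` if the seminorm is infinite — the steps that display `ψ(t)` as
a number state finiteness). [cite: Ramm2019, definition of ψ l.199] -/
def psi (v : ℝ → EuclideanSpace ℝ (Fin 3) → EuclideanSpace ℝ (Fin 3)) (t : ℝ) : ℝ := (psiE v t).toReal

/-- `ψ₀(t) := N₀(|ξ|F̃(ξ,t))` ((e10) l.263) for `f ≡ 0`, `F(·,t) = ∫ g(x−y) v₀(y) dy = e^{νtΔ}v₀` ((e3) l.142,
tree `heatTest ν v₀ t`), same normalisation as `psi`. [cite: Ramm2019, (e3) l.142 and (e10) l.263] -/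
def psi0 (ν : ℝ) (v₀ : EuclideanSpace ℝ (Fin 3) → EuclideanSpace ℝ (Fin 3)) (t : ℝ) : ℝ :=
  (Function.eHomSobolevSeminorm 1 (FunctionSpaces.EuclideanSpace.complexify ∘ heatTest ν v₀ t)).toReal

/-- `Φ_{1/4} ⋆ g (t) = Γ(¼)^{−1} ∫₀ᵗ (t−s)^{−3/4} g(s) ds`, the classical Abel integral of order `¼`
(`Φ_λ = t₊^{λ−1}/Γ(λ)`, l.237; integrable kernel). [cite: Ramm2019, definition of Φ_λ l.237–248] -/
def phiQuarter (g : ℝ → ℝ) (t : ℝ) : ℝ :=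
  (Real.Gamma (1 / 4 : ℝ))⁻¹ * volterra (-(3 / 4 : ℝ)) g t

/-- Inequality (e10) l.261–264 for the solution `v` with datum `(ν,v₀)`, constant `c` and
`w = Φ_{−1/4} ⋆ ψ`: `ψ(t) ≤ ψ₀(t) + cΓ(−¼) w(t) = ψ₀(t) − c·c₁·w(t)` for all `t > 0` (`Γ(−¼) = −4Γ(¾) =
−b^{−1}`, `c₁ = |Γ(−¼)| = b^{−1}`), `ψ(t)` a finite number. [cite: Ramm2019, (e10) l.258–264] -/
def HyperSingularIneq (ν : ℝ) (v₀ : EuclideanSpace ℝ (Fin 3) → EuclideanSpace ℝ (Fin 3))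
    (v : ℝ → EuclideanSpace ℝ (Fin 3) → EuclideanSpace ℝ (Fin 3)) (c : ℝ) (w : ℝ → ℝ) : Prop :=
  IsPhiConv (-(1 / 4 : ℝ)) (psi v) w ∧
    ∀ t : ℝ, 0 < t → psiE v t ≠ ⊤ ∧ psi v t ≤ psi0 ν v₀ t - c * c₁ * w t

/-- The majorant of (e11b) l.275–280 for datum `(ν,v₀)` and constant `c`: `h` continuous on `[0,∞)`,
`h = c^{−1}b Φ_{1/4}⋆ψ₀ − c^{−1}b Φ_{1/4}⋆h` on `[0,∞)` (`c^{−1}b = (c·c₁)^{−1}`), bounded on every `[0,T]`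
(«bounded by a constant depending only on the data … and T», l.279–280).
[cite: Ramm2019, (e11b) l.275–280] -/
def IsMajorant (ν : ℝ) (v₀ : EuclideanSpace ℝ (Fin 3) → EuclideanSpace ℝ (Fin 3)) (c : ℝ)
    (h : ℝ → ℝ) : Prop :=
  ContinuousOn h (Ici 0) ∧
    (∀ t : ℝ, 0 ≤ t → h t = (c * c₁)⁻¹ * phiQuarter (psi0 ν v₀) t - (c * c₁)⁻¹ * phiQuarter h t) ∧
    ∀ T : ℝ, 0 < T → ∃ C : ℝ, ∀ t ∈ Icc 0 T, |h t| ≤ C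

/-! ## The claimed theorem -/

/-- **Theorem 2** (l.171): «Problem (e1) has a solution in X and this solution is unique in X», `X =
C([0,T]; L²(ℝ³))`, «T > 0 an arbitrary large fixed number» — typed instance `f ≡ 0`, Clay data: for every
`ν > 0`, admissible `v₀` and `T > 0` there is an `X`-solution of (e2) on `[0,T]`, and any two agree (as
`L²` functions, i.e. a.e.) at every time of `[0,T]`. [claim: Ramm2019, status: disputed]
[cite: Ramm2019, Thm 2 l.171; Introduction l.111–122] -/
def ClaimedTheorem : Prop :=
  ∀ (ν : ℝ) (v₀ : EuclideanSpace ℝ (Fin 3) → EuclideanSpace ℝ (Fin 3)), DataHyp ν v₀ →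
    ∀ T : ℝ, 0 < T →
      (∃ v : ℝ → EuclideanSpace ℝ (Fin 3) → EuclideanSpace ℝ (Fin 3), InX ν v₀ T v) ∧
      ∀ v v' : ℝ → EuclideanSpace ℝ (Fin 3) → EuclideanSpace ℝ (Fin 3),
        InX ν v₀ T v → InX ν v₀ T v' → ∀ t ∈ Icc 0 T, v' t =ᵐ[volume] v t

/-! ## The steps -/

/-- **Step 1** — §2 (a) l.177–185 (first estimate of (e4), «known, see [L] and [R673]» l.167): energy
inequality `N₀(v(t)) ≤ ∫₀ᵗ N₀(f) ds + N₀(v₀)`; typed instance `f ≡ 0`: every global `X`-solution has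
`‖v(·,t)‖_{L²} ≤ ‖v₀‖_{L²}` for all `t ≥ 0` (norms in `ℝ≥0∞`). [claim: Ramm2019, status: disputed]
[cite: Ramm2019, §2 (a) l.177–185, (e4)] -/
def Step1_energyBound : Prop :=
  ∀ (ν : ℝ) (v₀ : EuclideanSpace ℝ (Fin 3) → EuclideanSpace ℝ (Fin 3))
    (v : ℝ → EuclideanSpace ℝ (Fin 3) → EuclideanSpace ℝ (Fin 3)),
    DataHyp ν v₀ → IsGlobalX ν v₀ v → ∀ t : ℝ, 0 ≤ t → eLpNorm (v t) 2 volume ≤ eLpNorm v₀ 2 volume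

/-- **Step 2** — §2 (b), the a priori inequality (e6) l.201–204 with the kernel bound (e7) l.210–212
(kernel `c[ν(t−s)]^{−5/4}`, not integrable at `s = t`) IN THE SENSE (e10) l.258–264: «One has
∫₀ᵗ(t−s)^{−5/4}ψ ds = Γ(−¼)Φ_{−1/4}⋆ψ. Inequality (e6) can be written as ψ ≤ ψ₀ + cΓ(−¼)Φ_{−1/4}⋆ψ». «c
stands for various constants independent of t» (l.205) — typed `∀ data, ∃ c > 0, ∀ solutions` (F11):
for every global `X`-solution there is `w = Φ_{−1/4} ⋆ ψ` (Laplace characterization) with `ψ(t)` finite and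
`ψ(t) ≤ ψ₀(t) − c·c₁·w(t)` for all `t > 0`. The 2019 twin of `Ramm2024.Step3_hyperSingularIneq`.
[claim: Ramm2019, status: disputed] [cite: Ramm2019, (e6) l.201–204, (e7) l.210–212, (e10) l.258–264] -/
def Step2_hyperSingularIneq : Prop :=
  ∀ (ν : ℝ) (v₀ : EuclideanSpace ℝ (Fin 3) → EuclideanSpace ℝ (Fin 3)), DataHyp ν v₀ →
    ∃ c : ℝ, 0 < c ∧
      ∀ v : ℝ → EuclideanSpace ℝ (Fin 3) → EuclideanSpace ℝ (Fin 3),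
        IsGlobalX ν v₀ v → ∃ w : ℝ → ℝ, HyperSingularIneq ν v₀ v c w

/-- **Step 3** — (e11b) l.275–280 with Lemma 1 (l.218–230) and Lemma 2 (l.232–236): for the data and EVERY
constant `c > 0` the majorant equation `h = c^{−1}bΦ_{1/4}⋆ψ₀ − c^{−1}bΦ_{1/4}⋆h` has a solution,
continuous and bounded on every `[0,T]` by a data constant. [claim: Ramm2019, status: disputed]
[cite: Ramm2019, (e11b) l.275–280; Lemma 1 l.218, Lemma 2 l.232] -/
def Step3_majorant : Prop :=
  ∀ (ν : ℝ) (v₀ : EuclideanSpace ℝ (Fin 3) → EuclideanSpace ℝ (Fin 3)), DataHyp ν v₀ →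
    ∀ c : ℝ, 0 < c → ∃ h : ℝ → ℝ, IsMajorant ν v₀ c h

/-- **Step 4** — (e11)→(e11a) l.265–274: «Applying to (e10) the operator Φ_{1/4}⋆ and multiplying by c^{−1}b
one gets (e11) ψ ≤ c^{−1}b Φ_{1/4}⋆ψ₀ − c^{−1}b Φ_{1/4}⋆ψ. Using Lemmas 1 and 2 one derives from (e11) by
iterations that (e11a) ψ(t) ≤ h(t)». Typed as the implication asserted for the solution at hand: (e10)
with constant `c` and the majorant `h` for the same `c` give `ψ ≤ h` on `[0,∞)`. The 2019 twin of
`Ramm2024.Step5_comparison`. [claim: Ramm2019, status: disputed]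
[cite: Ramm2019, (e11)–(e11a) l.265–274] -/
def Step4_comparison : Prop :=
  ∀ (ν : ℝ) (v₀ : EuclideanSpace ℝ (Fin 3) → EuclideanSpace ℝ (Fin 3))
    (v : ℝ → EuclideanSpace ℝ (Fin 3) → EuclideanSpace ℝ (Fin 3)),
    DataHyp ν v₀ → IsGlobalX ν v₀ v → ∀ c : ℝ, 0 < c → ∀ (w h : ℝ → ℝ),
      HyperSingularIneq ν v₀ v c w → IsMajorant ν v₀ c h → ∀ t : ℝ, 0 ≤ t → psi v t ≤ h t

/-- **Step 5** — Theorem 1, second estimate of (e4) (l.162–166; proof l.281–283 «By (e11a) the ψ is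
bounded by h. Since T > 0 is arbitrary, the second estimate (e4) is proved»): there is a continuous
`c : [0,∞) → ℝ`, depending on the data only, with `N₀(∇v(·,t)) ≤ c(t)` (finite) for every global
`X`-solution and every `t ≥ 0`. [claim: Ramm2019, status: disputed]
[cite: Ramm2019, Thm 1 (e4) l.162–166, l.281–283] -/
def Step5_aprioriBound : Prop :=
  ∀ (ν : ℝ) (v₀ : EuclideanSpace ℝ (Fin 3) → EuclideanSpace ℝ (Fin 3)), DataHyp ν v₀ →
    ∃ c : ℝ → ℝ, ContinuousOn c (Ici 0) ∧
      ∀ v : ℝ → EuclideanSpace ℝ (Fin 3) → EuclideanSpace ℝ (Fin 3),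
        IsGlobalX ν v₀ v → ∀ t : ℝ, 0 ≤ t → psiE v t ≠ ⊤ ∧ psi v t ≤ c t

/-- **Step 6** — Theorem 2, uniqueness in `X` (§3 l.294–322: (e12a) `w := ṽ₁ − ṽ₂`, the relation (e12)
`z ≤ c(Γ(¼)Φ_{1/4}⋆z + Γ(−¼)Φ_{−1/4}⋆z)`, (e13), «It follows from (e13) and (e11a) that z = 0»): two
`X`-solutions on `[0,T]` with the same data agree a.e. at every `t ∈ [0,T]`.
[claim: Ramm2019, status: disputed] [cite: Ramm2019, Thm 2 uniqueness, (e12a)–(e13) l.294–322] -/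
def Step6_uniqueness : Prop :=
  ∀ (ν : ℝ) (v₀ : EuclideanSpace ℝ (Fin 3) → EuclideanSpace ℝ (Fin 3)), DataHyp ν v₀ →
    ∀ T : ℝ, 0 < T → ∀ v v' : ℝ → EuclideanSpace ℝ (Fin 3) → EuclideanSpace ℝ (Fin 3),
      InX ν v₀ T v → InX ν v₀ T v' → ∀ t ∈ Icc 0 T, v' t =ᵐ[volume] v t

/-- **Step 7** — Theorem 2, local existence (§3 l.324–365, (e13a)–(e17): «B is a contraction on a ball
B_R … if τ is sufficiently small, 0 ≤ t ≤ τ … Therefore the solution to (e5) exists in X for t ≤ τ»):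
for the data there is `τ > 0` and an `X`-solution on `[0,τ]`. [claim: Ramm2019, status: disputed]
[cite: Ramm2019, (e13a)–(e17) l.324–365] -/
def Step7_localExistence : Prop :=
  ∀ (ν : ℝ) (v₀ : EuclideanSpace ℝ (Fin 3) → EuclideanSpace ℝ (Fin 3)), DataHyp ν v₀ →
    ∃ τ : ℝ, 0 < τ ∧ ∃ v : ℝ → EuclideanSpace ℝ (Fin 3) → EuclideanSpace ℝ (Fin 3), InX ν v₀ τ v

/-- **Step 8** — Theorem 2, continuation (§3 l.366–375): «The a priori estimates (e4) do not depend on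
τ ≤ T. Therefore one can repeat the argument for τ ≤ t ≤ 2τ considering the initial value to be ṽ(ξ,τ)
… Continue this process and in finitely many steps get the existence of the unique in X solution in
[0,T]»: a restart length `τ > 0` depending on the data only, by which EVERY `X`-solution on any `[0,T]`
extends to an `X`-solution on `[0,T+τ]` agreeing with it on `[0,T]`. [claim: Ramm2019, status: disputed]
[cite: Ramm2019, l.366–375] -/
def Step8_continuation : Prop :=
  ∀ (ν : ℝ) (v₀ : EuclideanSpace ℝ (Fin 3) → EuclideanSpace ℝ (Fin 3)), DataHyp ν v₀ →
    ∃ τ : ℝ, 0 < τ ∧ ∀ T : ℝ, 0 < T →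
      ∀ v : ℝ → EuclideanSpace ℝ (Fin 3) → EuclideanSpace ℝ (Fin 3), InX ν v₀ T v →
        ∃ v' : ℝ → EuclideanSpace ℝ (Fin 3) → EuclideanSpace ℝ (Fin 3),
          InX ν v₀ (T + τ) v' ∧ ∀ t ∈ Icc 0 T, v' t = v t

/-! ## Kernel composition (pure logic) -/

/-- Restriction of an `X`-solution to a shorter interval (definitional monotonicity of the tree
predicates). [cite: Ramm2019, definition of X l.150–156] -/
theorem InX.mono {ν : ℝ} {v₀ : EuclideanSpace ℝ (Fin 3) → EuclideanSpace ℝ (Fin 3)} {T T' : ℝ}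
    {v : ℝ → EuclideanSpace ℝ (Fin 3) → EuclideanSpace ℝ (Fin 3)} (h : InX ν v₀ T' v) (hT : T ≤ T') :
    InX ν v₀ T v :=
  ⟨h.1.mono (Icc_subset_Icc_right hT), h.2.1.mono (Icc_subset_Icc_right hT), h.2.2⟩

/-- Local existence (Step 7) + uniform continuation (Step 8), iterated: an `X`-solution on `[0, τ₇ + n τ₈]`
for every `n` (the printed «finitely many steps», l.374). [cite: Ramm2019, l.366–375] -/
theorem exists_InX_iterate {ν : ℝ} {v₀ : EuclideanSpace ℝ (Fin 3) → EuclideanSpace ℝ (Fin 3)}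
    {τ₇ τ₈ : ℝ} (h7 : 0 < τ₇ ∧ ∃ v : ℝ → EuclideanSpace ℝ (Fin 3) → EuclideanSpace ℝ (Fin 3), InX ν v₀ τ₇ v)
    (hτ₈ : 0 < τ₈)
    (h8 : ∀ T : ℝ, 0 < T → ∀ v : ℝ → EuclideanSpace ℝ (Fin 3) → EuclideanSpace ℝ (Fin 3),
      InX ν v₀ T v → ∃ v' : ℝ → EuclideanSpace ℝ (Fin 3) → EuclideanSpace ℝ (Fin 3),
        InX ν v₀ (T + τ₈) v' ∧ ∀ t ∈ Icc 0 T, v' t = v t)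
    (n : ℕ) :
    ∃ v : ℝ → EuclideanSpace ℝ (Fin 3) → EuclideanSpace ℝ (Fin 3), InX ν v₀ (τ₇ + n * τ₈) v := by
  induction n with
  | zero => simpa using h7.2
  | succ n ih =>
    obtain ⟨v, hv⟩ := ih
    have hT : 0 < τ₇ + n * τ₈ := by have := h7.1; positivity
    obtain ⟨v', hv', -⟩ := h8 _ hT v hv
    refine ⟨v', ?_⟩
    have : τ₇ + (n : ℝ) * τ₈ + τ₈ = τ₇ + ((n + 1 : ℕ) : ℝ) * τ₈ := by push_cast; ring
    rw [← this]
    exact hv'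

/-- The headline from the steps it consumes: Steps 6 (uniqueness), 7 (local existence) and 8 (uniform
continuation) give Theorem 2 on every `[0,T]` (Archimedes picks the number of restarts).
[cite: Ramm2019, Thm 2 and its proof l.289–375] -/
theorem claimedTheorem_of_steps_678 (h6 : Step6_uniqueness) (h7 : Step7_localExistence)
    (h8 : Step8_continuation) : ClaimedTheorem := by
  intro ν v₀ hD T hT
  refine ⟨?_, h6 ν v₀ hD T hT⟩
  obtain ⟨τ₇, hτ₇, v₇, hv₇⟩ := h7 ν v₀ hD
  obtain ⟨τ₈, hτ₈, hcont⟩ := h8 ν v₀ hD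
  obtain ⟨n, hn⟩ := exists_nat_gt (T / τ₈)
  obtain ⟨v, hv⟩ := exists_InX_iterate ⟨hτ₇, v₇, hv₇⟩ hτ₈ hcont n
  refine ⟨v, hv.mono ?_⟩
  have h1 : T < n * τ₈ := by
    have := (div_lt_iff₀ hτ₈).mp hn
    linarith
  linarith

/-- **COMPOSITION** (`claim_of_steps`): Steps 1–8, in the order of the module docstring's index, imply
the claimed theorem (Steps 1–5 feed the printed derivation of Step 8 and are not consumed in the
kernel). [cite: Ramm2019, §1 l.111–122; §§2–3] -/
theorem claim_of_steps :
    Step1_energyBound → Step2_hyperSingularIneq → Step3_majorant → Step4_comparison →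
      Step5_aprioriBound → Step6_uniqueness → Step7_localExistence → Step8_continuation →
        ClaimedTheorem :=
  fun _h1 _h2 _h3 _h4 _h5 h6 h7 h8 => claimedTheorem_of_steps_678 h6 h7 h8

/-! ## Clay link (Δ5) -/

/-- **ClayDelta (Δ5, SOLUTION NOTION)** — the exact extra hypothesis under which the claimed theorem
gives Clay (A): existence of `X`-solutions of the integral equation (e2) on every `[0,T]` (with
uniqueness) yields a Clay-sense solution — `u, p ∈ C^∞(ℝ³ × [0,∞))` solving (1)(2)(3) with `f ≡ 0` and
bounded energy (7) (`ClayVariants.clayR3.Solvable ν 0 v₀`). This is a regularity-and-gluing statement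
for mild `L²`-valued solutions that the paper neither states nor proves («By the solution a solution to
an integral equation is understood», abstract); it is NOT asserted here. [claim: Ramm2019, status: disputed]
[cite: Ramm2019, abstract l.100–103 and (e2) l.136–139 «Equation (e2) is equivalent to (e1)»] -/
def ClayDelta : Prop :=
  ∀ (ν : ℝ) (v₀ : EuclideanSpace ℝ (Fin 3) → EuclideanSpace ℝ (Fin 3)), DataHyp ν v₀ →
    (∀ T : ℝ, 0 < T →
      (∃ v : ℝ → EuclideanSpace ℝ (Fin 3) → EuclideanSpace ℝ (Fin 3), InX ν v₀ T v) ∧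
      ∀ v v' : ℝ → EuclideanSpace ℝ (Fin 3) → EuclideanSpace ℝ (Fin 3),
        InX ν v₀ T v → InX ν v₀ T v' → ∀ t ∈ Icc 0 T, v' t =ᵐ[volume] v t) →
    ClayVariants.clayR3.Solvable ν 0 v₀

/-- Modulo `ClayDelta`, the claimed theorem is Clay (A) (`ClayVariants.clayR3.Regularity`, token-for-token
the summit statement). [cite: Ramm2019, Introduction l.111–114 «This problem is solved in our paper»] -/
theorem clay_of_claimed (h : ClaimedTheorem) (hΔ : ClayDelta) : ClayVariants.clayR3.Regularity :=
  fun ν hν u₀ hsm hdiv hdec => hΔ ν u₀ ⟨hν, hsm, hdec, hdiv⟩ (h ν u₀ ⟨hν, hsm, hdec, hdiv⟩)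

/-! ## Rev 2 (ADDITIVE, ns-claims-typist-7 g4, 2026-08-27): the printed derivation «Steps 2–4 ⊢ Step 5»
(l.281–283) as a kernel theorem — C04b twin of `Ramm2024.step6_of_step3_step4_step5`. Nothing asserted. -/

/-- A Clay datum (smooth, rapidly decaying), complexified coordinatewise, lies in `Ḣ^s ∩ L²` for every
`s ≥ 0`: Fefferman's (4) is exactly the Schwartz decay of all derivatives, Schwartz ⊂ `H^s` (Mathlib
`SchwartzMap.memSobolev`) ⊂ `Ḣ^s ∩ L²` (`MemFourierSobolev.memHomSobolev_holds`). Same route as the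
compact-support lemma of `Theorems/SoloRefuteRamm2019.lean`. [folklore]
[cite: BahouriCheminDanchin2011, §1.4.1] -/
theorem memHomSobolev_complexify_of_dataHyp {ν : ℝ}
    {v₀ : EuclideanSpace ℝ (Fin 3) → EuclideanSpace ℝ (Fin 3)} (hD : DataHyp ν v₀) {s : ℝ} (hs : 0 ≤ s) :
    FunctionSpaces.MemHomSobolev s (FunctionSpaces.EuclideanSpace.complexify ∘ v₀) := by
  have hsm' : ContDiff ℝ ∞ (FunctionSpaces.EuclideanSpace.complexify ∘ v₀) :=
    FunctionSpaces.EuclideanSpace.contDiff_complexify_comp_iff.2 hD.data_smooth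
  have hdecay : ∀ k n : ℕ, ∃ C : ℝ, ∀ x : EuclideanSpace ℝ (Fin 3),
      ‖x‖ ^ k * ‖iteratedFDeriv ℝ n (FunctionSpaces.EuclideanSpace.complexify ∘ v₀) x‖ ≤ C := by
    intro k n
    obtain ⟨C, hC⟩ := hD.data_decay n k
    refine ⟨C, fun x => le_trans ?_ (hC x)⟩
    rw [(FunctionSpaces.EuclideanSpace.complexify (ι := Fin 3)).norm_iteratedFDeriv_comp_left
      hD.data_smooth.contDiffAt (mod_cast le_top)]
    exact mul_le_mul_of_nonneg_right
      (pow_le_pow_left₀ (norm_nonneg _) (le_add_of_nonneg_left zero_le_one) k) (norm_nonneg _)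
  set g : 𝓢(EuclideanSpace ℝ (Fin 3), EuclideanSpace ℂ (Fin 3)) :=
    ⟨FunctionSpaces.EuclideanSpace.complexify ∘ v₀, hsm', hdecay⟩ with hg
  have hMS : TemperedDistribution.MemSobolev s 2
      ((g.toLp 2 (volume : Measure (EuclideanSpace ℝ (Fin 3))) :
      𝓢'(EuclideanSpace ℝ (Fin 3), EuclideanSpace ℂ (Fin 3)))) := by
    have h := Lp.toTemperedDistribution_toLp_eq
      (μ := (volume : Measure (EuclideanSpace ℝ (Fin 3)))) (p := 2) g
    rw [show ((g : Lp (EuclideanSpace ℂ (Fin 3)) 2 (volume : Measure (EuclideanSpace ℝ (Fin 3))))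
      = g.toLp 2 volume) from rfl] at h
    rw [h]
    exact g.memSobolev
  have hfin := (FunctionSpaces.memSobolev_two_iff_eFourierSobolevNorm_lt_top_holds s _).1 hMS
  exact FunctionSpaces.MemFourierSobolev.memHomSobolev_holds hs ⟨g.memLp 2 _, hfin⟩

/-- `ψ(0) = N₀(∇v₀)` is finite for an `X`-solution from a Clay datum (`v 0 = v₀` by `InX`).
[cite: Ramm2019, definition of ψ l.199; (e1) data l.123–133] -/
theorem psiE_zero_ne_top {ν : ℝ} {v₀ : EuclideanSpace ℝ (Fin 3) → EuclideanSpace ℝ (Fin 3)} {T : ℝ}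
    {v : ℝ → EuclideanSpace ℝ (Fin 3) → EuclideanSpace ℝ (Fin 3)} (hD : DataHyp ν v₀)
    (hv : InX ν v₀ T v) : psiE v 0 ≠ ⊤ := by
  unfold psiE
  rw [hv.2.2]
  exact (memHomSobolev_complexify_of_dataHyp hD zero_le_one).eHomSobolevSeminorm_lt_top.ne

/-- **Steps 2–4 ⊢ Step 5, exactly as printed** (l.281–283: «By (e11a) the ψ is bounded by h. Since T > 0 is
arbitrary, the second estimate (e4) is proved»): Step 2 supplies the data constant `c` and, for each global
`X`-solution, the function `w` of (e10); Step 3 the majorant `h` for that `c` (continuous on `[0,∞)`, a data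
function); Step 4 gives `ψ ≤ h` on `[0,∞)`; finiteness of `ψ(t)` is part of (e10) for `t > 0` and is the
Schwartz-datum fact `psiE_zero_ne_top` at `t = 0`. The C04b twin of `Ramm2024.step6_of_step3_step4_step5`.
[cite: Ramm2019, proof of Thm 1, l.281–283] -/
theorem step5_of_step2_step3_step4 (h2 : Step2_hyperSingularIneq) (h3 : Step3_majorant)
    (h4 : Step4_comparison) : Step5_aprioriBound := by
  intro ν v₀ hD
  obtain ⟨c, hc, hall⟩ := h2 ν v₀ hD
  obtain ⟨h, hh⟩ := h3 ν v₀ hD c hc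
  refine ⟨h, hh.1, fun v hv t ht => ⟨?_, ?_⟩⟩
  · obtain ⟨w, hw⟩ := hall v hv
    rcases ht.eq_or_lt with rfl | htpos
    · exact psiE_zero_ne_top hD (hv 1 one_pos)
    · exact (hw.2 t htpos).1
  · obtain ⟨w, hw⟩ := hall v hv
    exact h4 ν v₀ v hD hv c hc w h hw hh t ht

/-! ## Step 3 discharged: the data function `ψ₀` is continuous and the majorant equation is solvable -/

namespace Step3Proof

open scoped FourierTransform
open Literature.Analysis.UnboundedOperators (heatExtension heatSymbol heatSymbol_le_one heatSymbol_pos)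
open Literature.Analysis.FunctionSpaces

variable {ν : ℝ} {v₀ : EuclideanSpace ℝ (Fin 3) → EuclideanSpace ℝ (Fin 3)}

/-- The Fourier-side expression `Ψ_V(σ) = ∫ ‖ξ‖² Ĝ_σ(ξ)² ‖𝓕V(ξ)‖² dξ` of `‖e^{σΔ}V‖²_{Ḣ¹}` is continuous
in `σ ∈ [0,∞)` whenever `∫ ‖ξ‖² ‖𝓕V‖² < ∞` (dominated convergence: `Ĝ_σ ≤ 1`, `σ ↦ Ĝ_σ(ξ)` continuous).
[folklore] -/
private theorem continuousWithinAt_lintegral_heatWeight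
    (V : Lp (EuclideanSpace ℂ (Fin 3)) 2 (volume : Measure (EuclideanSpace ℝ (Fin 3))))
    (hfin : ∫⁻ ξ, ‖ξ‖ₑ ^ (2 * (1 : ℝ)) *
        ‖((𝓕 V : Lp (EuclideanSpace ℂ (Fin 3)) 2 (volume : Measure (EuclideanSpace ℝ (Fin 3)))) :
          EuclideanSpace ℝ (Fin 3) → EuclideanSpace ℂ (Fin 3)) ξ‖ₑ ^ (2 : ℕ) ≠ ⊤)
    (σ₀ : ℝ) :
    ContinuousWithinAt (fun σ : ℝ => ∫⁻ ξ : EuclideanSpace ℝ (Fin 3), ‖ξ‖ₑ ^ (2 * (1 : ℝ)) *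
        (ENNReal.ofReal (heatSymbol σ ξ) ^ (2 : ℕ) *
          ‖((𝓕 V : Lp (EuclideanSpace ℂ (Fin 3)) 2 (volume : Measure (EuclideanSpace ℝ (Fin 3)))) :
            EuclideanSpace ℝ (Fin 3) → EuclideanSpace ℂ (Fin 3)) ξ‖ₑ ^ (2 : ℕ))) (Ici 0) σ₀ := by
  set Φ : EuclideanSpace ℝ (Fin 3) → ℝ≥0∞ := fun ξ =>
    ‖((𝓕 V : Lp (EuclideanSpace ℂ (Fin 3)) 2 (volume : Measure (EuclideanSpace ℝ (Fin 3)))) :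
      EuclideanSpace ℝ (Fin 3) → EuclideanSpace ℂ (Fin 3)) ξ‖ₑ ^ (2 : ℕ) with hΦ
  have hΦm : AEMeasurable Φ volume :=
    ((Lp.stronglyMeasurable _).aestronglyMeasurable.enorm.pow_const _)
  have hwm : AEMeasurable (fun ξ : EuclideanSpace ℝ (Fin 3) => (‖ξ‖ₑ : ℝ≥0∞) ^ (2 * (1 : ℝ))) volume :=
    (measurable_enorm.pow_const _).aemeasurable
  unfold ContinuousWithinAt
  refine tendsto_lintegral_filter_of_dominated_convergence'
    (fun ξ => (‖ξ‖ₑ : ℝ≥0∞) ^ (2 * (1 : ℝ)) * Φ ξ) ?_ ?_ hfin ?_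
  · -- measurability of every slice
    refine Eventually.of_forall fun σ => hwm.mul (AEMeasurable.mul ?_ hΦm)
    have hc : Continuous fun ξ : EuclideanSpace ℝ (Fin 3) => heatSymbol σ ξ := by
      unfold heatSymbol; fun_prop
    exact (ENNReal.measurable_ofReal.comp hc.measurable).aemeasurable.pow_const _
  · -- domination by `‖ξ‖² ‖𝓕V‖²` for `σ ≥ 0`
    filter_upwards [self_mem_nhdsWithin] with σ (hσ : 0 ≤ σ)
    refine Eventually.of_forall fun ξ => ?_
    calc (‖ξ‖ₑ : ℝ≥0∞) ^ (2 * (1 : ℝ)) * (ENNReal.ofReal (heatSymbol σ ξ) ^ (2 : ℕ) * Φ ξ)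
        ≤ (‖ξ‖ₑ : ℝ≥0∞) ^ (2 * (1 : ℝ)) * (1 ^ (2 : ℕ) * Φ ξ) := by
          gcongr
          exact ENNReal.ofReal_le_one.2 (heatSymbol_le_one hσ ξ)
      _ = _ := by rw [one_pow, one_mul]
  · -- pointwise continuity in `σ`
    refine Eventually.of_forall fun ξ => ?_
    have hc : Continuous fun σ : ℝ => heatSymbol σ ξ := by unfold heatSymbol; fun_prop
    have h1 : Tendsto (fun σ : ℝ => ENNReal.ofReal (heatSymbol σ ξ) ^ (2 : ℕ)) (𝓝[Ici 0] σ₀)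
        (𝓝 (ENNReal.ofReal (heatSymbol σ₀ ξ) ^ (2 : ℕ))) :=
      (((ENNReal.continuous_pow 2).comp (ENNReal.continuous_ofReal.comp hc)).tendsto σ₀).mono_left
        nhdsWithin_le_nhds
    have h2 : Tendsto (fun σ : ℝ => ENNReal.ofReal (heatSymbol σ ξ) ^ (2 : ℕ) * Φ ξ) (𝓝[Ici 0] σ₀)
        (𝓝 (ENNReal.ofReal (heatSymbol σ₀ ξ) ^ (2 : ℕ) * Φ ξ)) :=
      ENNReal.Tendsto.mul_const h1 (Or.inr (by simp [hΦ]))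
    exact ENNReal.Tendsto.const_mul h2 (Or.inr (by simp))

/-- For a Clay datum and `t > 0`: the complexified caloric field is the heat extension of the complexified
datum at time `νt`. [folklore] -/
private theorem complexify_heatTest_of_pos (hD : DataHyp ν v₀) {t : ℝ} (ht : 0 < t) :
    FunctionSpaces.EuclideanSpace.complexify ∘ heatTest ν v₀ t =
      heatExtension (FunctionSpaces.EuclideanSpace.complexify ∘ v₀) (ν * t) := by
  rw [heatTest_of_pos hD.viscosity_pos ht, FunctionSpaces.EuclideanSpace.complexify_comp_heatExtension]

/-- **`ψ₀` is continuous on `[0,∞)`** for a Clay datum: `ψ₀(t)² = (2π)^{-2}∫ ‖ξ‖² e^{−2(2π)²νt‖ξ‖²}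
‖𝓕v₀(ξ)‖² dξ`, continuous by dominated convergence against `‖ξ‖²‖𝓕v₀‖² ∈ L¹` (`v₀ ∈ Ḣ¹`).
[folklore] [cite: Ramm2019, (e10) l.263 (definition of ψ₀) of arXiv:1904.11569v1] -/
theorem continuousOn_psi0 (hD : DataHyp ν v₀) : ContinuousOn (psi0 ν v₀) (Ici 0) := by
  have hν := hD.viscosity_pos
  set V : EuclideanSpace ℝ (Fin 3) → EuclideanSpace ℂ (Fin 3) :=
    FunctionSpaces.EuclideanSpace.complexify ∘ v₀ with hV
  have hVH : MemHomSobolev 1 V := memHomSobolev_complexify_of_dataHyp hD zero_le_one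
  have hV2 : MemLp V 2 (volume : Measure (EuclideanSpace ℝ (Fin 3))) := hVH.memLp
  -- the Fourier-side expression
  set Ψ : ℝ → ℝ≥0∞ := fun σ => ∫⁻ ξ : EuclideanSpace ℝ (Fin 3), ‖ξ‖ₑ ^ (2 * (1 : ℝ)) *
      (ENNReal.ofReal (heatSymbol σ ξ) ^ (2 : ℕ) *
        ‖((𝓕 (hV2.toLp V) : Lp (EuclideanSpace ℂ (Fin 3)) 2 (volume : Measure (EuclideanSpace ℝ (Fin 3)))) :
          EuclideanSpace ℝ (Fin 3) → EuclideanSpace ℂ (Fin 3)) ξ‖ₑ ^ (2 : ℕ)) with hΨ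
  -- `‖ξ‖²‖𝓕V‖² ∈ L¹`
  have hfin : ∫⁻ ξ, ‖ξ‖ₑ ^ (2 * (1 : ℝ)) *
      ‖((𝓕 (hV2.toLp V) : Lp (EuclideanSpace ℂ (Fin 3)) 2 (volume : Measure (EuclideanSpace ℝ (Fin 3)))) :
        EuclideanSpace ℝ (Fin 3) → EuclideanSpace ℂ (Fin 3)) ξ‖ₑ ^ (2 : ℕ) ≠ ⊤ := by
    have h := hVH.eHomSobolevSeminorm_lt_top
    rw [Function.eHomSobolevSeminorm_of_memLp hV2, FunctionSpaces.eHomSobolevSeminorm] at h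
    intro htop
    rw [htop, ENNReal.top_rpow_of_pos (by norm_num)] at h
    exact lt_irrefl _ h
  -- `ψ₀(t) = (Ψ(νt))^{1/2}` as a real number, `t ≥ 0`
  have hrepr : ∀ t ∈ Ici (0 : ℝ), psi0 ν v₀ t = ((Ψ (ν * t)) ^ (1 / 2 : ℝ)).toReal := by
    intro t ht
    rcases (mem_Ici.1 ht).eq_or_lt with h0 | hpos
    · subst h0
      unfold psi0
      rw [heatTest_zero_right, mul_zero, Function.eHomSobolevSeminorm_of_memLp hV2,
        FunctionSpaces.eHomSobolevSeminorm, hΨ]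
      simp only [Literature.Analysis.UnboundedOperators.heatSymbol_zero, Pi.one_apply, ENNReal.ofReal_one,
        one_pow, one_mul]
    · have hσ : 0 < ν * t := mul_pos hν hpos
      unfold psi0
      rw [complexify_heatTest_of_pos hD hpos,
        Function.eHomSobolevSeminorm_of_memLp (memLp_two_heatExtension hV2 hσ),
        FunctionSpaces.eHomSobolevSeminorm, lintegral_hom_weight_fourier_heatExtension hV2 hσ 1]
  -- `Ψ` is finite on `[0,∞)`
  have hΨfin : ∀ σ, 0 ≤ σ → Ψ σ ≠ ⊤ := by
    intro σ hσ
    refine ne_top_of_le_ne_top hfin (lintegral_mono fun ξ => ?_)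
    calc (‖ξ‖ₑ : ℝ≥0∞) ^ (2 * (1 : ℝ)) * (ENNReal.ofReal (heatSymbol σ ξ) ^ (2 : ℕ) * _)
        ≤ (‖ξ‖ₑ : ℝ≥0∞) ^ (2 * (1 : ℝ)) * (1 ^ (2 : ℕ) * _) := by
          gcongr
          exact ENNReal.ofReal_le_one.2 (heatSymbol_le_one hσ ξ)
      _ = _ := by rw [one_pow, one_mul]
  -- continuity
  intro t ht
  have ht0 : 0 ≤ t := ht
  have hmap : MapsTo (fun t : ℝ => ν * t) (Ici 0) (Ici 0) := fun s hs =>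
    mem_Ici.2 (mul_nonneg hν.le hs)
  have hΨc : ContinuousWithinAt Ψ (Ici 0) (ν * t) :=
    continuousWithinAt_lintegral_heatWeight (hV2.toLp V) hfin (ν * t)
  have hcomp : ContinuousWithinAt (fun s : ℝ => Ψ (ν * s)) (Ici 0) t :=
    hΨc.comp ((continuous_const.mul continuous_id).continuousWithinAt) hmap
  have hrpow : ContinuousWithinAt (fun s : ℝ => (Ψ (ν * s)) ^ (1 / 2 : ℝ)) (Ici 0) t :=
    ((ENNReal.continuous_rpow_const).tendsto _).comp hcomp
  have hne : (Ψ (ν * t)) ^ (1 / 2 : ℝ) ≠ ⊤ :=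
    ENNReal.rpow_ne_top_of_nonneg (by norm_num) (hΨfin _ (mul_nonneg hν.le ht0))
  have hreal : ContinuousWithinAt (fun s : ℝ => ((Ψ (ν * s)) ^ (1 / 2 : ℝ)).toReal) (Ici 0) t :=
    (ENNReal.tendsto_toReal hne).comp hrpow
  exact hreal.congr (fun s hs => hrepr s hs) (hrepr t ht)


end Step3Proof

open Step3Proof in
/-- **Step 3 holds** ((e11b) l.275–280 with Lemma 1 l.218–230 and Lemma 2 l.232–236 of arXiv:1904.11569v1:
«the equation h = c⁻¹bΦ_{1/4}⋆ψ₀ − c⁻¹bΦ_{1/4}⋆h is solvable by iterations and the iterations converge by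
Lemma 2 … h is bounded by a constant depending only on the data»), PROVED as typed: the data function
`ψ₀(t) = ‖e^{νtΔ}v₀‖_{Ḣ¹}` is continuous on `[0,∞)` (`Step3Proof.continuousOn_psi0`: Fourier side + dominated
convergence), so `g = (c·c₁)⁻¹Φ_{1/4}⋆ψ₀` is continuous, and the Abel equation `h = −(c·c₁)⁻¹Γ(¼)⁻¹·A_{−3/4}h + g`
has exactly one continuous solution on every `[0,N+1]` (`Ramm2024.Lemma21.exists_solution_smul`, Lemma 2.1 of
the 2024 paper with a scalar coefficient); the solutions are compatible along `N` by uniqueness and glue to an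
`h ∈ C([0,∞))`, bounded on every `[0,T]` by compactness. In-file discharge (D-0026) of a TRUE support step;
the row's verdict is untouched — Step 3 is not the kill step. [cite: Ramm2019, (e11b) l.275–280; Lemma 1
l.218–230, Lemma 2 l.232–236 of arXiv:1904.11569v1] -/
theorem step3_majorant_holds : Step3_majorant := by
  intro ν v₀ hD c hc
  have ha : (-1 : ℝ) < -(3 / 4 : ℝ) := by norm_num
  set κ : ℝ := (c * c₁)⁻¹ with hκ
  set lam : ℝ := -(κ * (Real.Gamma (1 / 4 : ℝ))⁻¹) with hlam
  set g : ℝ → ℝ := fun t => κ * phiQuarter (psi0 ν v₀) t with hg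
  have hψc : ContinuousOn (psi0 ν v₀) (Ici 0) := continuousOn_psi0 hD
  have hgc : ∀ T : ℝ, 0 < T → ContinuousOn g (Icc 0 T) := fun T hT =>
    continuousOn_const.mul (continuousOn_const.mul (Ramm2024.Lemma21.continuousOn_volterra_of_continuousOn ha hT (hψc.mono Icc_subset_Ici_self)))
  -- the solutions on `[0, N+1]`, `N : ℕ`
  have hex : ∀ N : ℕ, ∃ q : ℝ → ℝ, ContinuousOn q (Icc 0 ((N : ℝ) + 1)) ∧
      (∀ t ∈ Icc 0 ((N : ℝ) + 1), q t = lam * volterra (-(3 / 4 : ℝ)) q t + g t) ∧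
      ∀ q' : ℝ → ℝ, ContinuousOn q' (Icc 0 ((N : ℝ) + 1)) →
        (∀ t ∈ Icc 0 ((N : ℝ) + 1), q' t = lam * volterra (-(3 / 4 : ℝ)) q' t + g t) →
          ∀ t ∈ Icc 0 ((N : ℝ) + 1), q' t = q t := fun N =>
    Ramm2024.Lemma21.exists_solution_smul ha (by positivity) lam (hgc _ (by positivity))
  choose Q hQc hQeq hQuniq using hex
  -- compatibility along `N`
  have hcompat : ∀ N M : ℕ, N ≤ M → ∀ t ∈ Icc 0 ((N : ℝ) + 1), Q M t = Q N t := by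
    intro N M hNM
    have hsub : Icc (0 : ℝ) ((N : ℝ) + 1) ⊆ Icc 0 ((M : ℝ) + 1) :=
      Icc_subset_Icc_right (by exact_mod_cast Nat.succ_le_succ hNM)
    exact hQuniq N (Q M) ((hQc M).mono hsub) fun t ht => hQeq M t (hsub ht)
  -- the glued function
  set h : ℝ → ℝ := fun t => Q ⌊t⌋₊ t with hh
  have hmemfloor : ∀ t : ℝ, 0 ≤ t → t ∈ Icc 0 ((⌊t⌋₊ : ℝ) + 1) := fun t ht =>
    ⟨ht, (Nat.lt_floor_add_one t).le⟩
  have hagree : ∀ N : ℕ, ∀ t ∈ Icc 0 ((N : ℝ) + 1), h t = Q N t := by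
    intro N t ht
    have h1 := hcompat N (max N ⌊t⌋₊) (le_max_left _ _) t ht
    have h2 := hcompat ⌊t⌋₊ (max N ⌊t⌋₊) (le_max_right _ _) t (hmemfloor t ht.1)
    show Q ⌊t⌋₊ t = Q N t
    rw [← h2, h1]
  refine ⟨h, ?_, ?_, ?_⟩
  · -- continuity on `[0, ∞)`
    intro t₀ ht₀
    have ht₀' : (0 : ℝ) ≤ t₀ := ht₀
    set N : ℕ := ⌊t₀⌋₊ + 1 with hN
    have hlt : t₀ < (N : ℝ) + 1 := by
      have := Nat.lt_floor_add_one t₀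
      rw [hN]; push_cast; linarith
    have hmem : Icc (0 : ℝ) ((N : ℝ) + 1) ∈ 𝓝[Ici 0] t₀ :=
      mem_nhdsWithin.2 ⟨Iio ((N : ℝ) + 1), isOpen_Iio, hlt, fun s hs => ⟨hs.2, (mem_Iio.1 hs.1).le⟩⟩
    have hQ : ContinuousWithinAt (Q N) (Ici 0) t₀ :=
      (hQc N t₀ ⟨ht₀', hlt.le⟩).mono_of_mem_nhdsWithin hmem
    refine hQ.congr_of_eventuallyEq ?_ (hagree N t₀ ⟨ht₀', hlt.le⟩)
    filter_upwards [hmem] with s hs using hagree N s hs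
  · -- the equation `h = κ Φ_{1/4}⋆ψ₀ − κ Φ_{1/4}⋆h` on `[0, ∞)`
    intro t ht
    have htI := hmemfloor t ht
    have e1 : h t = Q ⌊t⌋₊ t := rfl
    have e2 := hQeq ⌊t⌋₊ t htI
    have e3 : volterra (-(3 / 4 : ℝ)) (Q ⌊t⌋₊) t = volterra (-(3 / 4 : ℝ)) h t :=
      Ramm2024.Lemma21.volterra_congr_Icc ht fun s hs => (hagree ⌊t⌋₊ s ⟨hs.1, hs.2.trans htI.2⟩).symm
    rw [e1, e2, e3, hg, hlam]
    simp only [phiQuarter]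
    ring
  · -- boundedness on every `[0, T]`
    intro T hT
    have hc' : ContinuousOn h (Icc 0 T) := by
      refine fun t ht => ((hQc ⌊T⌋₊ t ⟨ht.1, ht.2.trans (Nat.lt_floor_add_one T).le⟩).mono
        (Icc_subset_Icc_right (Nat.lt_floor_add_one T).le)).congr (fun s hs => ?_) ?_
      · exact hagree ⌊T⌋₊ s ⟨hs.1, hs.2.trans (Nat.lt_floor_add_one T).le⟩
      · exact hagree ⌊T⌋₊ t ⟨ht.1, ht.2.trans (Nat.lt_floor_add_one T).le⟩
    obtain ⟨C, hC⟩ := isCompact_Icc.exists_bound_of_continuousOn hc'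
    exact ⟨C, fun t ht => (Real.norm_eq_abs _).symm.le.trans (hC t ht)⟩

/-- `Step3_majorant` — `_holds` alias of `step3_majorant_holds` above under the fact's exact name (appended
2026-08-28, D-0026 bookkeeping: the proof term is the existing theorem of this file; no statement,
definition or attribute is edited; no new named fact; the ledger's debt table listed the fact
unproved). [cite: Ramm2019, (e11b) l.275–280; Lemma 1 l.218, Lemma 2 l.232] -/
theorem _root_.Literature.Claims.NS.Ramm2019.Step3_majorant_holds : Step3_majorant :=
  _root_.Literature.Claims.NS.Ramm2019.step3_majorant_holds

end

end Literature.Claims.NS.Ramm2019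

-- WHAT THIS IS NOT: not a claim about NS regularity or blow-up; not a claim about any author beyond
-- the typed locator.
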